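import Summits.QuantumFields.BalabanUV.Beta.CompositeOneShotJetData
import Summits.QuantumFields.BalabanUV.Beta.ChartConjugationReflection
import Summits.QuantumFields.BalabanUV.Beta.SecondOrderTransport

/-!
# `BalabanUV.Beta.NVertexSectors` — row D1 ∕ (C1), PART 10: **THE N-SYSTEM's FIRST-ORDER VERTEX `VN R P j` IS THREE CHAIN-RULE VERTICES THROUGH
# THE N-CHART COLUMN — WILSON, BORDER, Λ — AND ITS FIELD–FIELD BLOCK HAS EXACTLY TWO SECTORS (the border table is `fb ∕ bf` only)**

WHY (located).  The END wrapper `FP/StepRecursionFeedNestedNamedB.d1Tel_JcComp_ctr_named` (p405971 ✓) binds the torus N-jets to the row's lattice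
objects by `hHN₁ : H'₁f (dv (μ,y)) = (perF T (dper T (VN (Roots.ctr Lc) Pn (n+1) μ y)))|ff`.  Road «FP» g37 (SPEC-48 §E (E3), `FP/TorusHSideJetPeriodic`
p414074 ✓) wrote the pinned `H₁f v` as `perF T (dper T 𝒱)` for ONE displayed lattice kernel `𝒱 = (−2c)·Σ_b hb b·wilsonA b + Σ_{j ≤ n} 𝒦_j`, and (E3b)
plans the `X`-conjugation of `hH'₁f` as a further lattice kernel `𝒳 x y a b = c·(λ̃ x − λ̃ y)·K₀ x y (inl a) (inl b)`; (E4) ∕ (C1) is the match of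
`𝒳 + 𝒱` against the `ff` block of the row's `VN (n+1) μ y`.  THIS FILE is the row's side of that match AT THE BLOCK LEVEL, by name:
`VN R P j = vertexOfK (AN R j) (Lc^(j+1)) (JNat R P (j+1)).S` (F6d-2 `VN_eq`) with `(JNat R P (j+1)).S = S0NOf 3 (Lc^(j+1)) (compV …) (compH …) cE cVH cΛ`
(`SchartOf … 0`, `SrecOf_zero` — §2 `JNat_S_eq_S0NOf`, `rfl`), and `S0NOf = cE • wilsonA + cVH • V + cΛ • SLam N (lamCoeffOf (KInv N) N) H`; the chain-rule vertex
is additive over uniformly bounded families for a decaying column kernel (an2 g35 `ChartConjugationReflection.vertexOfK_add`, `SecondOrderTransport.vertexOfK_smul_family`),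
so **`VN R P j = cE (j+1) • 𝒲N + cVH (j+1) • 𝒱bN + cΛ (j+1) • ℒN`** (§2 `VN_eq_sectors`) with the three chain-rule vertices through the SAME column
`colH (AN R j) (Lc^(j+1)) μ y` of the N-chart: `𝒲N := vertexOfK (AN R j) (Lc^(j+1)) (wilsonA 3)`, `𝒱bN := vertexOfK … (compV R.r Lc (j+1))`,
`ℒN := vertexOfK … (SLam (Lc^(j+1)) (lamCoeffOf (KInv (Lc^(j+1))) (Lc^(j+1))) (compH R.r Lc (j+1)))`.  The border table is a `packVH` (F3 `compVhS`, node 7a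
`packVH_inl_inl`): its field–field entries VANISH, so **`VN R P j μ y x z (inl α) (inl β) = cE (j+1) · 𝒲N μ y x z (inl α) (inl β) + cΛ (j+1) · ℒN μ y x z (inl α) (inl β)`**
(§2 `VN_inl_inl`, and written out as lattice sums `VN_inl_inl_tsum`) — the `ff` block the binder `hHN₁` reads has a Wilson sector and a Λ sector and NOTHING ELSE;
in particular NO sector of the commutator shape `(λ̃ x − λ̃ y)·K₀ x y` (located for road «FP» (E3b): where #21's `X`-conjugation is matched is a junction
question, J-RISK-1′, not answered here).  §3: each sector is a vertex family at the coarse bond (letters for `perF ∘ dper` additivity on the road's side).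

WHAT ([folklore] bookkeeping BY NAME over F6d-2, F6d-1b, F3, leaf-10's `S0NOf`, an2 g35's vertex algebra, an4's `vertexOfK`; no `def`, no `def … : Prop`,
nothing cited, 0 sorry): §1 generic blocking `N`, generic column kernel `K`, generic tables `V H` under (LV)(LH): `bdd_wilsonA`, `bdd_of_LV`, `bdd_SLam_of_LH`,
**`vertexOfK_S0NOf`** (three sectors), `vertexOfK_inl_inl_of_ff_zero`, `vertexOfK_S0NOf_inl_inl`; §2 at the record (`R : Roots Lc`, `P : Pins`, door index `j`):
`JNat_S_eq_S0NOf`, `decays_AN`, `compV_inl_inl`, **`VN_eq_sectors`**, `vertexOfK_compV_inl_inl`, **`VN_inl_inl`**, `VN_inl_inl_tsum`; §3 `vertexFamily_WN`,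
`vertexFamily_VbN`, `vertexFamily_LN`.
WHAT THIS IS NOT: not the periodisation `perF T (dper T ·)` of the sectors (PART 11, by an2 g42's `CombHId1Letters.dper_vertexOfK_eq_sum` at `K := AN R j`);
not the junction `hb (n+1) ↔` the torus column of `perF T (AN R (n+1))` nor `cE ↔ −2c` (J-RISK-1, the wrapper's displayed data — instantiation is the road's);
not the Λ-sector's storey unrolling (F6a′ `compVHKer_unroll`, F6a″, F6a‴, PART 8 — landed); not the `X`-conjugation; no row of the END wrapper discharged;
0 estimates; nothing of Bałaban's asserted, valued or discharged; 0∕4 row-D1 binders (hW, hR, D1Tel, D1Rep); ROOT M‴ p325680 ∕ P5c ∕ D6 untouched;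
NOT (C1), NOT (L2′), NOT D1, NEVER «G-an2-4 closed», NOT BetaPertH, NOT continuum, NOT Clay.

HONEST DEPENDENCY (page 1, mandatory): continuum YM on T⁴ ⇐ BetaPertH ∧ nine spine estimates (0/9 proved); BetaPertH ⇐ (D1) ∧ (D4) ∧ CAP+tail;
G-an2-4 gates asym, D1 and NE2/3/4.  HONEST FRAMING (cell contract, verbatim): «discharging `BetaPertH` makes Bałaban's UV stability UNCONDITIONAL —
a real constructive-QFT result; it is NOT the continuum limit and NOT the Clay problem.»  ABSOLUTE RULE (cell charter, verbatim): «No internally-minted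
statement may enter as a cited fact. Every hypothesis is either kernel-proved in this package or a verbatim quotation of a PUBLISHED theorem with page
reference. The manuscript(s) under audit are NOT citable for their own disputed steps — they are the thing under adjudication; programme-internal
(2001/route/tribunal) claims are never citable.»  Row D1 ∕ (C1) OWNER an2 (b2b-balaban-beta-an2) gen 61, 2026-08-26.  No existing file touched.
-/

noncomputable section

open scoped BigOperators

namespace Summit.QuantumFields.BalabanUV.Beta.NVertexSectors

open Finset
open Literature.MathematicalPhysics.QuantumFieldTheory
open Literature.MathematicalPhysics.QuantumFieldTheory.Balaban1983to89
open Literature.MathematicalPhysics.QuantumFieldTheory.Balaban1983to89.Beta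
open ExpKernelCalculus (MKer Decays BiLoc VertexFamily)
open AffineAveraging (Site box toSite)
open AveragingHessianKernels (packVH_inl_inl)
open OneStepResolventKernel (Fib KInv LocStencil wsum decays_KInv)
open OneStepKernelFamily (colH vertexOfK vertexFamily_vertexOfK')
open InterLevelTransport (SLam locStencil_SLam)
open StepJetData (wilsonA wBound locStencil_wilsonA)
open BalabanStepJets (lamCoeffOf abs_lamCoeffOf_le)
open Summit.QuantumFields.BalabanUV.Beta.AxialDressingRooted (one_le_of_neZero)
open Summit.QuantumFields.BalabanUV.Beta.SpineRooted (S0NOf)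
open Summit.QuantumFields.BalabanUV.Beta.WardLocusRecursive (SrecOf_zero)
open Summit.QuantumFields.BalabanUV.Beta.ChartStepJets (SchartOf_eq)
open Summit.QuantumFields.BalabanUV.Beta.CompositeVertexKernelRec (compVhS)
open Summit.QuantumFields.BalabanUV.Beta.CompositeCorrectorDress (compChart)
open Summit.QuantumFields.BalabanUV.Beta.CompositeOneShotJets (compV compH compV_hV compH_hH tabsComp_V tabsComp_H decays_compChart)
open Summit.QuantumFields.BalabanUV.Beta.CompositeOneShotJetData (Roots Pins JNat JNat_S AN AN_eq VN VN_eq)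
open Summit.QuantumFields.BalabanUV.Beta.ChartConjugationReflection (vertexOfK_add abs_le_of_locStencil)
open Summit.QuantumFields.BalabanUV.Beta.SecondOrderTransport (vertexOfK_smul_family)

variable {d : ℕ}

/-! ## §1 Generic blocking `N`, generic column kernel `K`, generic tables `V H` under (LV)(LH) -/

section Generic

variable {N : ℕ} [NeZero N] (K : MKer (d + 1) (Fib d)) (V H : Fin (d + 1) → Site (d + 1) → MKer (d + 1) (Fib d)) (cE cVH cΛ : ℝ)

omit [NeZero N] in
/-- [folklore] the Wilson table is uniformly bounded (lit `locStencil_wilsonA` at rate `0`). -/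
theorem bdd_wilsonA (κ' : Fin (d + 1)) (u x z : Site (d + 1)) (a b : Fib d) : |wilsonA d κ' u x z a b| ≤ wBound d := by
  have h := abs_le_of_locStencil (locStencil_wilsonA (d := d) le_rfl) le_rfl κ' u x z a b
  rwa [mul_zero, Real.exp_zero, mul_one] at h

omit [NeZero N] in
/-- [folklore] an (LV) table is uniformly bounded. -/
theorem bdd_of_LV {V : Fin (d + 1) → Site (d + 1) → MKer (d + 1) (Fib d)} (hV : ∀ δ : ℝ, 0 ≤ δ → ∃ C : ℝ, LocStencil V C δ) :
    ∃ B : ℝ, ∀ κ' u x z a b, |V κ' u x z a b| ≤ B := by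
  obtain ⟨C, hC⟩ := hV 0 le_rfl
  exact ⟨C, fun κ' u x z a b => abs_le_of_locStencil hC le_rfl κ' u x z a b⟩

/-- [folklore] the Λ-table `SLam N (lamCoeffOf (KInv N) N) H` of an (LH) table is uniformly bounded (`locStencil_SLam` with `abs_lamCoeffOf_le` at the decay of `KInv N`). -/
theorem bdd_SLam_of_LH {H : Fin (d + 1) → Site (d + 1) → MKer (d + 1) (Fib d)} (hH : ∀ δ : ℝ, 0 ≤ δ → ∃ C : ℝ, VertexFamily H N C δ) :
    ∃ B : ℝ, ∀ κ' u x z a b, |SLam N (lamCoeffOf (KInv (N := N) (d := d)) N) H κ' u x z a b| ≤ B := by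
  obtain ⟨δ₀, C, hδ₀, hC, hdec⟩ := decays_KInv (N := N) (d := d)
  have hc := abs_lamCoeffOf_le (N := N) hdec hC hδ₀.le
  obtain ⟨Cq, hQ⟩ := hH δ₀ hδ₀.le
  have h3 := locStencil_SLam (N := N) hc hQ hδ₀ (mul_nonneg (mul_nonneg (by positivity) hC) (Real.exp_pos _).le)
  exact ⟨_, fun κ' u x z a b => abs_le_of_locStencil h3 (by positivity) κ' u x z a b⟩

/-- [folklore] the three slices of `S0NOf`, entrywise (leaf-10's definition read pointwise). -/
theorem S0NOf_apply_eq (κ' : Fin (d + 1)) (u x z : Site (d + 1)) (a b : Fib d) :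
    S0NOf d N V H cE cVH cΛ κ' u x z a b =
      cE * wilsonA d κ' u x z a b + (cVH * V κ' u x z a b + cΛ * SLam N (lamCoeffOf (KInv (N := N) (d := d)) N) H κ' u x z a b) := by
  simp only [S0NOf, Pi.add_apply, Pi.smul_apply, smul_eq_mul, add_assoc]

/-- [folklore] **`vertexOfK_S0NOf` — THE CHAIN-RULE VERTEX OF THE SLOTTED NATIVE SPINE IS THREE CHAIN-RULE VERTICES THROUGH THE SAME COLUMN**:
for a decaying column kernel `K` and tables under (LV)(LH),
`vertexOfK K N (S0NOf d N V H cE cVH cΛ) μ y = cE • vertexOfK K N (wilsonA d) μ y + cVH • vertexOfK K N V μ y + cΛ • vertexOfK K N (SLam N (lamCoeffOf (KInv N) N) H) μ y`. -/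
theorem vertexOfK_S0NOf (hK : ∃ δ C : ℝ, 0 < δ ∧ 0 ≤ C ∧ Decays K C δ) (hV : ∀ δ : ℝ, 0 ≤ δ → ∃ C : ℝ, LocStencil V C δ)
    (hH : ∀ δ : ℝ, 0 ≤ δ → ∃ C : ℝ, VertexFamily H N C δ) (μ : Fin (d + 1)) (y : Site (d + 1)) :
    vertexOfK K N (S0NOf d N V H cE cVH cΛ) μ y =
      cE • vertexOfK K N (wilsonA d) μ y + cVH • vertexOfK K N V μ y +
        cΛ • vertexOfK K N (SLam N (lamCoeffOf (KInv (N := N) (d := d)) N) H) μ y := by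
  obtain ⟨BV, hBV⟩ := bdd_of_LV hV
  obtain ⟨BΛ, hBΛ⟩ := bdd_SLam_of_LH (N := N) hH
  set BW : ℝ := wBound d with hBW
  have hW := bdd_wilsonA (d := d)
  have h0W : 0 ≤ BW := (abs_nonneg _).trans (hW 0 0 0 0 (Sum.inl 0) (Sum.inl 0))
  have h0V : 0 ≤ BV := (abs_nonneg _).trans (hBV 0 0 0 0 (Sum.inl 0) (Sum.inl 0))
  have h0Λ : 0 ≤ BΛ := (abs_nonneg _).trans (hBΛ 0 0 0 0 (Sum.inl 0) (Sum.inl 0))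
  -- one common bound for the three scaled families and their partial sums
  set B : ℝ := |cE| * BW + |cVH| * BV + |cΛ| * BΛ with hB
  have h1 : ∀ κ' u x z a b, |(cE • wilsonA d κ' u) x z a b| ≤ B := fun κ' u x z a b => by
    rw [Pi.smul_apply, Pi.smul_apply, Pi.smul_apply, Pi.smul_apply, smul_eq_mul, abs_mul]
    have := mul_le_mul_of_nonneg_left (hW κ' u x z a b) (abs_nonneg cE)
    nlinarith [mul_nonneg (abs_nonneg cVH) h0V, mul_nonneg (abs_nonneg cΛ) h0Λ]
  have h2 : ∀ κ' u x z a b, |(cVH • V κ' u) x z a b| ≤ B := fun κ' u x z a b => by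
    rw [Pi.smul_apply, Pi.smul_apply, Pi.smul_apply, Pi.smul_apply, smul_eq_mul, abs_mul]
    have := mul_le_mul_of_nonneg_left (hBV κ' u x z a b) (abs_nonneg cVH)
    nlinarith [mul_nonneg (abs_nonneg cE) h0W, mul_nonneg (abs_nonneg cΛ) h0Λ]
  have h3 : ∀ κ' u x z a b, |(cΛ • SLam N (lamCoeffOf (KInv (N := N) (d := d)) N) H κ' u) x z a b| ≤ B + B := fun κ' u x z a b => by
    rw [Pi.smul_apply, Pi.smul_apply, Pi.smul_apply, Pi.smul_apply, smul_eq_mul, abs_mul]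
    have := mul_le_mul_of_nonneg_left (hBΛ κ' u x z a b) (abs_nonneg cΛ)
    nlinarith [mul_nonneg (abs_nonneg cE) h0W, mul_nonneg (abs_nonneg cVH) h0V, mul_nonneg (abs_nonneg cΛ) h0Λ]
  have h12 : ∀ κ' u x z a b, |(cE • wilsonA d κ' u + cVH • V κ' u) x z a b| ≤ B + B := fun κ' u x z a b => by
    rw [Pi.add_apply, Pi.add_apply, Pi.add_apply, Pi.add_apply]
    exact (abs_add_le _ _).trans (add_le_add (h1 κ' u x z a b) (h2 κ' u x z a b))
  -- the definition, split twice
  have e : S0NOf d N V H cE cVH cΛ =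
      fun κ' u => (fun κ u => cE • wilsonA d κ u + cVH • V κ u) κ' u +
        (fun κ u => cΛ • SLam N (lamCoeffOf (KInv (N := N) (d := d)) N) H κ u) κ' u := rfl
  have hadd₁ := vertexOfK_add (N := N) hK (S := fun κ u => cE • wilsonA d κ u + cVH • V κ u)
    (T := fun κ u => cΛ • SLam N (lamCoeffOf (KInv (N := N) (d := d)) N) H κ u) h12 h3 μ y
  have hadd₂ := vertexOfK_add (N := N) hK (S := fun κ u => cE • wilsonA d κ u) (T := fun κ u => cVH • V κ u) h1 h2 μ y
  rw [e, hadd₁, hadd₂, vertexOfK_smul_family, vertexOfK_smul_family, vertexOfK_smul_family]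

omit [NeZero N] in
/-- [folklore] **a family with NO field–field block has a chain-rule vertex with no field–field block** (every term of the column sum vanishes). -/
theorem vertexOfK_inl_inl_of_ff_zero {S : Fin (d + 1) → Site (d + 1) → MKer (d + 1) (Fib d)}
    (hS : ∀ (κ' : Fin (d + 1)) (u x z : Site (d + 1)) (α β : Fin (d + 1)), S κ' u x z (Sum.inl α) (Sum.inl β) = 0)
    (μ : Fin (d + 1)) (y x z : Site (d + 1)) (α β : Fin (d + 1)) : vertexOfK K N S μ y x z (Sum.inl α) (Sum.inl β) = 0 := by
  simp only [vertexOfK, wsum, hS, mul_zero, tsum_zero, Finset.sum_const_zero]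

/-- [folklore] **THE FIELD–FIELD BLOCK OF THE NATIVE SPINE's VERTEX HAS TWO SECTORS** when the border table has no field–field block:
`vertexOfK K N (S0NOf …) μ y x z (inl α) (inl β) = cE · vertexOfK K N (wilsonA d) μ y x z (inl α) (inl β) + cΛ · vertexOfK K N (SLam …) μ y x z (inl α) (inl β)`. -/
theorem vertexOfK_S0NOf_inl_inl (hK : ∃ δ C : ℝ, 0 < δ ∧ 0 ≤ C ∧ Decays K C δ) (hV : ∀ δ : ℝ, 0 ≤ δ → ∃ C : ℝ, LocStencil V C δ)
    (hH : ∀ δ : ℝ, 0 ≤ δ → ∃ C : ℝ, VertexFamily H N C δ)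
    (hV0 : ∀ (κ' : Fin (d + 1)) (u x z : Site (d + 1)) (α β : Fin (d + 1)), V κ' u x z (Sum.inl α) (Sum.inl β) = 0)
    (μ : Fin (d + 1)) (y x z : Site (d + 1)) (α β : Fin (d + 1)) :
    vertexOfK K N (S0NOf d N V H cE cVH cΛ) μ y x z (Sum.inl α) (Sum.inl β) =
      cE * vertexOfK K N (wilsonA d) μ y x z (Sum.inl α) (Sum.inl β) +
        cΛ * vertexOfK K N (SLam N (lamCoeffOf (KInv (N := N) (d := d)) N) H) μ y x z (Sum.inl α) (Sum.inl β) := by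
  rw [vertexOfK_S0NOf K V H cE cVH cΛ hK hV hH μ y]
  simp only [Pi.add_apply, Pi.smul_apply, smul_eq_mul, vertexOfK_inl_inl_of_ff_zero K hV0, mul_zero, add_zero]

end Generic

/-! ## §2 At the record: the N-system's vertex `VN R P j` -/

section Record

variable {Lc : ℕ} [NeZero Lc] (R : Roots Lc) (P : Pins)

/-- [folklore] **the first-order family of the raw composite jets at depth `m` IS the slotted native spine over the composite tables** (`SchartOf … 0`, `SrecOf_zero`,
`tabsComp_V ∕ _H` — `rfl`): `(JNat R P m).S = S0NOf 3 (Lc^m) (compV R.r Lc m) (compH R.r Lc m) (cE m) (cVH m) (cΛ m)`. -/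
theorem JNat_S_eq_S0NOf (m : ℕ) :
    (JNat R P m).S = S0NOf 3 (Lc ^ m) (compV R.r Lc m) (compH R.r Lc m) (P.cE m) (P.cVH m) (P.cΛ m) := by
  rw [JNat_S, SchartOf_eq, SrecOf_zero, tabsComp_V, tabsComp_H]

/-- [folklore] the N-chart decays (F6d-1b `decays_compChart` at the record's roots). -/
theorem decays_AN (j : ℕ) : ∃ δ C : ℝ, 0 < δ ∧ 0 ≤ C ∧ Decays (AN R j) C δ := by
  rw [AN_eq]
  exact decays_compChart (one_le_of_neZero Lc) R.hrc (j + 1) (R.hs (j + 1))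

omit [NeZero Lc] in
/-- [folklore] **THE COMPOSITE BORDER TABLE HAS NO FIELD–FIELD BLOCK** (F3 `compVhS = packVH …`, node 7a `packVH_inl_inl`). -/
theorem compV_inl_inl (r : Fin (d + 1) → ℕ) (L m : ℕ) (κ' : Fin (d + 1)) (u x z : Site (d + 1)) (α β : Fin (d + 1)) :
    compV r L m κ' u x z (Sum.inl α) (Sum.inl β) = 0 := by
  simp only [compV, compVhS, packVH_inl_inl]

/-- [folklore] **`VN_eq_sectors` — THE N-SYSTEM's FIRST-ORDER VERTEX IS THREE CHAIN-RULE VERTICES THROUGH THE N-CHART COLUMN: WILSON, BORDER, Λ.** -/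
theorem VN_eq_sectors (j : ℕ) :
    VN R P j =
      P.cE (j + 1) • vertexOfK (AN R j) (Lc ^ (j + 1)) (wilsonA 3) +
        P.cVH (j + 1) • vertexOfK (AN R j) (Lc ^ (j + 1)) (compV R.r Lc (j + 1)) +
        P.cΛ (j + 1) • vertexOfK (AN R j) (Lc ^ (j + 1))
          (SLam (Lc ^ (j + 1)) (lamCoeffOf (KInv (N := Lc ^ (j + 1)) (d := 3)) (Lc ^ (j + 1))) (compH R.r Lc (j + 1))) := by
  funext μ y
  rw [VN_eq, JNat_S_eq_S0NOf]
  have h := vertexOfK_S0NOf (N := Lc ^ (j + 1)) (AN R j) (compV R.r Lc (j + 1)) (compH R.r Lc (j + 1)) (P.cE (j + 1)) (P.cVH (j + 1))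
    (P.cΛ (j + 1)) (decays_AN R j) (compV_hV (j + 1) (one_le_of_neZero Lc) R.hr) (compH_hH (j + 1) (one_le_of_neZero Lc) R.hr) μ y
  rw [h]
  simp only [Pi.add_apply, Pi.smul_apply]

/-- [folklore] the border sector has no field–field block. -/
theorem vertexOfK_compV_inl_inl (K : MKer (d + 1) (Fib d)) (N : ℕ) (r : Fin (d + 1) → ℕ) (L m : ℕ) (μ : Fin (d + 1)) (y x z : Site (d + 1))
    (α β : Fin (d + 1)) : vertexOfK K N (compV r L m) μ y x z (Sum.inl α) (Sum.inl β) = 0 :=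
  vertexOfK_inl_inl_of_ff_zero K (compV_inl_inl r L m) μ y x z α β

/-- [folklore] **`VN_inl_inl` — THE FIELD–FIELD BLOCK OF THE N-SYSTEM's VERTEX HAS EXACTLY TWO SECTORS, WILSON AND Λ** (the block the binder `hHN₁` reads):
`VN R P j μ y x z (inl α) (inl β) = cE (j+1) · 𝒲N μ y x z (inl α) (inl β) + cΛ (j+1) · ℒN μ y x z (inl α) (inl β)`. -/
theorem VN_inl_inl (j : ℕ) (μ : Fin (3 + 1)) (y x z : Site (3 + 1)) (α β : Fin (3 + 1)) :
    VN R P j μ y x z (Sum.inl α) (Sum.inl β) =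
      P.cE (j + 1) * vertexOfK (AN R j) (Lc ^ (j + 1)) (wilsonA 3) μ y x z (Sum.inl α) (Sum.inl β) +
        P.cΛ (j + 1) * vertexOfK (AN R j) (Lc ^ (j + 1))
          (SLam (Lc ^ (j + 1)) (lamCoeffOf (KInv (N := Lc ^ (j + 1)) (d := 3)) (Lc ^ (j + 1))) (compH R.r Lc (j + 1))) μ y x z
          (Sum.inl α) (Sum.inl β) := by
  rw [VN_eq_sectors]
  simp only [Pi.add_apply, Pi.smul_apply, smul_eq_mul, vertexOfK_compV_inl_inl, mul_zero, add_zero]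

/-- [folklore] **the same block written out as lattice sums** — the display the road's `𝒳 + 𝒱` is to be matched against:
`VN R P j μ y x z (inl α) (inl β) = cE (j+1) · Σ_{κ′} Σ'_u (AN R j) u (Lc^{j+1}•y) (inl κ′) (inr μ) · wilsonA 3 κ′ u x z (inl α) (inl β)
 + cΛ (j+1) · Σ_{κ′} Σ'_u (AN R j) u (Lc^{j+1}•y) (inl κ′) (inr μ) · SLam … κ′ u x z (inl α) (inl β)`. -/
theorem VN_inl_inl_tsum (j : ℕ) (μ : Fin (3 + 1)) (y x z : Site (3 + 1)) (α β : Fin (3 + 1)) :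
    VN R P j μ y x z (Sum.inl α) (Sum.inl β) =
      P.cE (j + 1) * ∑ κ' : Fin (3 + 1), ∑' u : Site (3 + 1),
          AN R j u (((Lc ^ (j + 1) : ℕ) : ℤ) • y) (Sum.inl κ') (Sum.inr μ) * wilsonA 3 κ' u x z (Sum.inl α) (Sum.inl β) +
        P.cΛ (j + 1) * ∑ κ' : Fin (3 + 1), ∑' u : Site (3 + 1),
          AN R j u (((Lc ^ (j + 1) : ℕ) : ℤ) • y) (Sum.inl κ') (Sum.inr μ) *
            SLam (Lc ^ (j + 1)) (lamCoeffOf (KInv (N := Lc ^ (j + 1)) (d := 3)) (Lc ^ (j + 1))) (compH R.r Lc (j + 1)) κ' u x z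
              (Sum.inl α) (Sum.inl β) := by
  rw [VN_inl_inl]
  rfl

end Record

/-! ## §3 Letters: each sector is a vertex family at the coarse bond -/

section Letters

variable {Lc : ℕ} [NeZero Lc] (R : Roots Lc) (j : ℕ)

/-- [folklore] the Wilson sector `𝒲N` is a vertex family at blocking `Lc^(j+1)` (an4 `vertexFamily_vertexOfK'` with lit `locStencil_wilsonA`). -/
theorem vertexFamily_WN : ∃ Cv δv : ℝ, 0 < δv ∧ VertexFamily (vertexOfK (AN R j) (Lc ^ (j + 1)) (wilsonA 3)) (Lc ^ (j + 1)) Cv δv :=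
  vertexFamily_vertexOfK' (N := Lc ^ (j + 1)) (decays_AN R j) (locStencil_wilsonA (d := 3) (δ := 1) zero_le_one) zero_lt_one

/-- [folklore] the border sector `𝒱bN` is a vertex family at blocking `Lc^(j+1)` ((LV) at rate `1`). -/
theorem vertexFamily_VbN :
    ∃ Cv δv : ℝ, 0 < δv ∧ VertexFamily (vertexOfK (AN R j) (Lc ^ (j + 1)) (compV R.r Lc (j + 1))) (Lc ^ (j + 1)) Cv δv := by
  obtain ⟨C, hC⟩ := compV_hV (j + 1) (one_le_of_neZero Lc) R.hr 1 zero_le_one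
  exact vertexFamily_vertexOfK' (N := Lc ^ (j + 1)) (decays_AN R j) hC zero_lt_one

/-- [folklore] the Λ sector `ℒN` is a vertex family at blocking `Lc^(j+1)` (`locStencil_SLam` with `abs_lamCoeffOf_le` at the decay of `KInv (Lc^(j+1))` and (LH)). -/
theorem vertexFamily_LN :
    ∃ Cv δv : ℝ, 0 < δv ∧ VertexFamily (vertexOfK (AN R j) (Lc ^ (j + 1))
      (SLam (Lc ^ (j + 1)) (lamCoeffOf (KInv (N := Lc ^ (j + 1)) (d := 3)) (Lc ^ (j + 1))) (compH R.r Lc (j + 1)))) (Lc ^ (j + 1)) Cv δv := by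
  obtain ⟨δ₀, C, hδ₀, hC, hdec⟩ := decays_KInv (N := Lc ^ (j + 1)) (d := 3)
  have hc := abs_lamCoeffOf_le (N := Lc ^ (j + 1)) hdec hC hδ₀.le
  obtain ⟨Cq, hQ⟩ := compH_hH (j + 1) (one_le_of_neZero Lc) R.hr δ₀ hδ₀.le
  have h3 := locStencil_SLam (N := Lc ^ (j + 1)) hc hQ hδ₀ (mul_nonneg (mul_nonneg (by positivity) hC) (Real.exp_pos _).le)
  exact vertexFamily_vertexOfK' (N := Lc ^ (j + 1)) (decays_AN R j) h3 (by positivity)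

end Letters

end Summit.QuantumFields.BalabanUV.Beta.NVertexSectors

end
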